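import Literature.Topology.FourManifolds.PlanarLefschetzBody
import Literature.Topology.PlaneTopology.ArgumentIncrement
import Literature.Topology.PlaneTopology.LoopWinding
import HarnessLib

/-!
# Winding numbers of vanishing cycles of planar Lefschetz bodies: the cycle realising a syntactic
# curve encloses exactly the holes of its hole set; re-spelling invariance of `Realises`

Topic `Literature/Topology/FourManifolds`, sequel to `PlanarLefschetzBody.lean` (D-b of the
vocabulary programme of the crux `ConvexBisection.PlanarAcyclicBisectionRigidity`) over the tree's
plane-topology library (`PlaneTopology/WindingNumber.lean`, `ArgumentIncrement.lean`,
`LoopWinding.lean`).  Everything here is PROVED; no named facts.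

The planar Lefschetz body `X(P_n; w)` (`IsPlanarLefschetzBody X n w`) records its vanishing cycles
only up to FREE HOMOTOPY in the page: the `i`-th signed cycle `γ` REALISES the syntactic curve
`c = g(c_[a,b])` of the `i`-th letter when its core, read in the topological model page
`PlanarPage n ⊂ ℂ`, is freely homotopic to the loop spelled in the lassos by
`PlanarCurve.cls n c ∈ F_n` (`SignedCycle.Realises`).  The two readers of the dictionary that look
at the cycles — the `H₁` reader (`PlanarWords.planarLefschetzBody_unimodular_of_isZero_H1`:
`H₁(X(F; w)) = H₁(F)/⟨[γᵢ]⟩`, Gompf–Stipsicz 1999, §8.2, p. 292) and Oba's endgame (which 1-handle of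
`P_n × D²` a vanishing cycle cancels: the ones of the holes it encloses, Oba 2016, §3.2, Fig. 2) —
both start from the HOMOLOGY CLASS of the core in `H₁(P_n; ℤ) = ℤⁿ`, i.e. from its winding numbers
about the `n` hole centres.  This file computes them:

* §1 `PlanarWords.holeExp j : F_n →* ℤ` — the exponent sum of the lasso `x_j` (the `j`-th
  coordinate of the abelianisation `F_n → F_nᵃᵇ = ℤⁿ`); arc-data automorphisms (mapping classes)
  act on it through their hole permutation (`holeExp_aut`), so the class `cls n c = g_*(x_a ⋯ x_b)`
  of the syntactic curve `g(c_[a,b])` has exponent `1` at the holes of its HOLE SET `π_g([a, b])`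
  and `0` elsewhere (`holeExp_cls`).
* §2 `PlanarPage.holeWinding j` — the winding number about the centre `c_j` of hole `j` of a loop
  in the page, a function on path-homotopy classes (`wind_pathLoop_eq_of_homotopic`); additive
  under concatenation, odd under reversal, invariant under conjugation by a path (variation of the
  argument, `Path.argInc`); the lasso `x_k` winds `δ_{jk}` about `c_j` (`holeWinding_lasso`: the
  hole circuit is a round circle about its own centre and stays `ρ`-close to `c_k ≠ c_j`
  otherwise, Rouché); hence **the loop spelled by `w ∈ F_n` winds `holeExp j w` times about `c_j`**
  (`holeWinding_wordClass`).
* §3 **The core of a cycle realising `c` winds `holeExp j (cls n c)` times about `c_j`**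
  (`SignedCycle.Realises.wind_core_sub_holeCentre`): the vanishing cycle encloses, homologically,
  exactly the holes of the syntactic hole set — the first step of both readers above.
* §4 **Re-spelling invariance**: `Realises n c γ` depends only on the conjugacy class of
  `cls n c` (`SignedCycle.Realises.of_isConj`), hence `IsPlanarLefschetzBody X n w` and
  `IsPlanarWordManifold M n w` are invariant under replacing letters by letters of the same sign
  with conjugate classes (`IsPlanarLefschetzBody.of_forall₂_isConj`,
  `IsPlanarWordManifold.of_forall₂_isConj`) — the bookkeeping form of "only the isotopy class of
  the vanishing cycle matters" promised in `PlanarLefschetzBody.lean`, Faithfulness (a), (d).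

## References
* R. E. Gompf, A. I. Stipsicz, *4-Manifolds and Kirby Calculus*, GSM 20 (1999), §8.2 (p. 292:
  `H₁` of a Lefschetz fibration over `D²`). [GompfStipsiczGSM1999]
* T. Oba, *Stein fillings of homology 3-spheres and mapping class groups*, Geom. Dedicata 183
  (2016), §3.2 (arXiv:1407.5257). [Oba2016]
* B. Farb, D. Margalit, *A Primer on Mapping Class Groups* (2012), §1.2.3, §1.3 (free homotopy
  classes of curves; the lassos of `D_n`). [FarbMargalit2012]
* L. V. Ahlfors, *Complex Analysis*, 3rd ed. (1979), §4.2.1 (winding numbers). [Ahlfors1979]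
-/

noncomputable section

open Set Function Complex
open scoped Real
open Literature.Topology.PlaneTopology

namespace Literature.Topology.FourManifolds

open PlanarWords (PlanarCurve Letter)

/-! ### §1 Exponent sums of the lassos -/

namespace PlanarWords

variable {n : ℕ}

/-- **The exponent sum of the lasso `x_j`** in a word of `F_n`: the homomorphism `F_n → ℤ`
(written multiplicatively) with `x_j ↦ 1`, `x_i ↦ 0` for `i ≠ j` — the `j`-th coordinate of the
abelianisation `F_n → H₁(P_n; ℤ) = ℤⁿ`. [folklore] -/
def holeExp (j : Fin n) : FreeGroup (Fin n) →* Multiplicative ℤ :=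
  FreeGroup.lift fun i => if i = j then Multiplicative.ofAdd 1 else 1

/-- Exponent sum of a generator. [folklore] -/
theorem holeExp_of (j i : Fin n) :
    holeExp j (FreeGroup.of i) = if i = j then Multiplicative.ofAdd 1 else 1 := by
  simp [holeExp]

/-- The lasso `x_j` has exponent sum `1` at `j`. [folklore] -/
@[simp] theorem holeExp_of_self (j : Fin n) :
    holeExp j (FreeGroup.of j) = Multiplicative.ofAdd 1 := by
  simp [holeExp]

/-- The lasso `x_i`, `i ≠ j`, has exponent sum `0` at `j`. [folklore] -/
theorem holeExp_of_ne {j i : Fin n} (h : i ≠ j) : holeExp j (FreeGroup.of i) = 1 := by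
  simp [holeExp, h]

/-- **Mapping classes act on exponent sums through their hole permutation**: the arc-data
automorphism `x_i ↦ u_i x_{π i} u_i⁻¹` satisfies `holeExp j (φ_* x) = holeExp (π⁻¹ j) x` (the
conjugations die in the abelian group `ℤ`). [folklore] -/
theorem holeExp_aut (φ : ArcData n) (j : Fin n) (x : FreeGroup (Fin n)) :
    holeExp j (φ.aut x) = holeExp (φ.perm.symm j) x := by
  suffices h : (holeExp j).comp φ.aut = holeExp (φ.perm.symm j) from DFunLike.congr_fun h x
  refine FreeGroup.ext_hom _ _ fun i => ?_
  simp [ArcData.aut, holeExp_of, Equiv.eq_symm_apply]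

/-- Exponent sums of a product of generators count occurrences. [folklore] -/
theorem toAdd_holeExp_prod_map_of (j : Fin n) (L : List (Fin n)) :
    Multiplicative.toAdd (holeExp j (L.map FreeGroup.of).prod) = L.count j := by
  induction L with
  | nil => simp
  | cons a L ih =>
      rw [List.map_cons, List.prod_cons, map_mul, toAdd_mul, ih, List.count_cons, holeExp_of]
      by_cases h : a = j
      · subst h; simp; ring
      · simp [h]

/-- **Exponent sums of a round block**: `x_a ⋯ x_b` has exponent `1` at the holes `a ≤ j ≤ b` and
`0` at the others. [folklore] -/
theorem toAdd_holeExp_blockWord (j : Fin n) (a b : ℕ) :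
    Multiplicative.toAdd (holeExp j (PGen.blockWord n a b)) = if a ≤ j.val ∧ j.val ≤ b then 1 else 0 := by
  classical
  rw [PGen.blockWord, toAdd_holeExp_prod_map_of]
  set L := (List.finRange n).filter fun i => decide (a ≤ i.val ∧ i.val ≤ b) with hL
  have hnd : L.Nodup := (List.nodup_finRange n).filter _
  by_cases h : a ≤ j.val ∧ j.val ≤ b
  · have hj : j ∈ L := by
      rw [hL, List.mem_filter]
      exact ⟨List.mem_finRange j, by simpa using h⟩
    rw [if_pos h, List.count_eq_one_of_mem hnd hj]
    rfl
  · have hj : j ∉ L := by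
      rw [hL, List.mem_filter]
      simpa using h
    rw [if_neg h, List.count_eq_zero_of_not_mem hj]
    rfl

/-- **The hole set of a syntactic curve, read by exponent sums.**  The class
`cls n c = g_*(x_a ⋯ x_b)` of `c = g(c_[a,b])` has exponent `1` at the hole `j` iff `π_g⁻¹(j)` lies
in the round block `[a, b]`, where `π_g` is the hole permutation of the carrying word `g`: the
curve `g(c_[a,b])` encloses the holes `π_g([a, b])`. [folklore] -/
theorem toAdd_holeExp_cls (j : Fin n) (c : PlanarCurve) :
    Multiplicative.toAdd (holeExp j (c.cls n)) =
      if c.a ≤ ((evalWord n c.g).perm.symm j).val ∧ ((evalWord n c.g).perm.symm j).val ≤ c.b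
      then 1 else 0 := by
  rw [PlanarCurve.cls, holeExp_aut, toAdd_holeExp_blockWord]

/-- Exponent sums of the class of a syntactic curve are `0` or `1` (simple closed curves of a
planar surface have primitive `0/1` homology classes). [folklore] -/
theorem toAdd_holeExp_cls_eq_zero_or_eq_one (j : Fin n) (c : PlanarCurve) :
    Multiplicative.toAdd (holeExp j (c.cls n)) = 0 ∨ Multiplicative.toAdd (holeExp j (c.cls n)) = 1 := by
  rw [toAdd_holeExp_cls]
  split_ifs <;> simp

/-- **An in-range curve encloses a hole**: for `c = g(c_[a,b])` with `a ≤ b < n`, the hole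
`π_g(a)` has exponent `1`. [folklore] -/
theorem toAdd_holeExp_cls_perm (c : PlanarCurve) (hab : c.a ≤ c.b) (hb : c.b < n) :
    Multiplicative.toAdd
        (holeExp ((evalWord n c.g).perm ⟨c.a, hab.trans_lt hb⟩) (c.cls n)) = 1 := by
  rw [toAdd_holeExp_cls, Equiv.symm_apply_apply, if_pos ⟨le_rfl, hab⟩]

/-- **Exponent sums factor through the abelianisation** `F_n → F_nᵃᵇ` (the target is abelian):
the induced homomorphism `F_nᵃᵇ → ℤ`. [folklore] -/
def holeExpAb (j : Fin n) : Abelianization (FreeGroup (Fin n)) →* Multiplicative ℤ :=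
  Abelianization.lift (holeExp j)

/-- The factorisation through the abelianisation. [folklore] -/
@[simp] theorem holeExpAb_of (j : Fin n) (x : FreeGroup (Fin n)) :
    holeExpAb j (Abelianization.of x) = holeExp j x := by
  simp [holeExpAb]

/-- **Conjugate classes have equal exponent sums** (the exponent sum is a class function).
[folklore] -/
theorem holeExp_eq_of_isConj (j : Fin n) {x y : FreeGroup (Fin n)} (h : IsConj x y) :
    holeExp j x = holeExp j y := by
  obtain ⟨u, hu⟩ := h
  have := congrArg (holeExp j) hu.eq
  rw [map_mul, map_mul] at this
  -- `holeExp u * holeExp x = holeExp y * holeExp u` in the commutative group `ℤ`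
  rwa [mul_comm, mul_left_inj] at this

end PlanarWords

/-! ### §2 Winding numbers of page loops about the hole centres -/

namespace PlanarPage

variable {n : ℕ}

/-- Points of the page are off the hole centres (they keep distance `≥ ρ > 0`). [folklore] -/
theorem coe_ne_holeCentre (x : PlanarPage n) (j : Fin n) : (x : ℂ) ≠ holeCentre n j := by
  intro h
  have h1 := x.2.2 j
  rw [h, sub_self, norm_zero] at h1
  exact absurd h1 (not_le.2 (holeRadius_pos n))

/-- The hole centres are off every page path read in `ℂ`. [folklore] -/
theorem holeCentre_notMem_range_map {x y : PlanarPage n} (p : Path x y) (j : Fin n) :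
    (holeCentre n j : ℂ) ∉ range (p.map continuous_subtype_val) := by
  rintro ⟨t, ht⟩
  exact coe_ne_holeCentre (p t) j ht

/-- **The winding number about the centre `c_j` of hole `j` of a loop class of the page**: the
winding number of `t ↦ p(t) - c_j` for any representative loop `p` (homotopic loops have the same
winding number about a point off the page, `wind_pathLoop_eq_of_homotopic`).  This is the `j`-th
coordinate of the class of the loop in `H₁(P_n; ℤ) = ℤⁿ`. [cite: Ahlfors1979, §4.2.1] -/
def holeWinding (j : Fin n) {x : PlanarPage n} : Path.Homotopic.Quotient x x → ℤ :=
  Quotient.lift (fun p : Path x x => wind fun t => pathLoop Subtype.val p t - holeCentre n j)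
    fun _ _ h => wind_pathLoop_eq_of_homotopic continuous_subtype_val h fun y => coe_ne_holeCentre y j

/-- The winding number of the class of a loop is that of the loop. [folklore] -/
theorem holeWinding_mk (j : Fin n) {x : PlanarPage n} (p : Path x x) :
    holeWinding j (Path.Homotopic.Quotient.mk p) =
      wind fun t => pathLoop Subtype.val p t - holeCentre n j := rfl

/-- **Winding number = variation of the argument / `2πi`** along the loop read in `ℂ`.
[cite: Ahlfors1979, §4.2.1] -/
theorem argInc_map_eq_holeWinding_mul (j : Fin n) {x : PlanarPage n} (p : Path x x) :
    (p.map continuous_subtype_val).argInc (holeCentre n j) =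
      holeWinding j (Path.Homotopic.Quotient.mk p) * (2 * π * I) := by
  rw [Path.argInc_eq_wind_mul _ (holeCentre_notMem_range_map p j), holeWinding_mk]
  rfl

/-- **Additivity**: the winding number of a concatenation is the sum. [folklore] -/
theorem holeWinding_trans (j : Fin n) {x : PlanarPage n} (P Q : Path.Homotopic.Quotient x x) :
    holeWinding j (P.trans Q) = holeWinding j P + holeWinding j Q := by
  induction P using Path.Homotopic.Quotient.ind with | mk p =>
  induction Q using Path.Homotopic.Quotient.ind with | mk q =>
  rw [← Path.Homotopic.Quotient.mk_trans]
  apply int_eq_of_mul_two_pi_I_eq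
  rw [← argInc_map_eq_holeWinding_mul, Path.map_trans,
    Path.argInc_trans _ _ (holeCentre_notMem_range_map p j) (holeCentre_notMem_range_map q j),
    argInc_map_eq_holeWinding_mul, argInc_map_eq_holeWinding_mul]
  push_cast
  ring

/-- **Reversal** negates the winding number. [folklore] -/
theorem holeWinding_symm (j : Fin n) {x : PlanarPage n} (P : Path.Homotopic.Quotient x x) :
    holeWinding j P.symm = -holeWinding j P := by
  induction P using Path.Homotopic.Quotient.ind with | mk p =>
  rw [← Path.Homotopic.Quotient.mk_symm]
  apply int_eq_of_mul_two_pi_I_eq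
  rw [← argInc_map_eq_holeWinding_mul, ← Path.map_symm,
    Path.argInc_symm _ (holeCentre_notMem_range_map p j), argInc_map_eq_holeWinding_mul]
  push_cast
  ring

/-- The constant loop has winding number `0`. [folklore] -/
theorem holeWinding_refl (j : Fin n) (x : PlanarPage n) :
    holeWinding j (Path.Homotopic.Quotient.refl x) = 0 := by
  rw [← Path.Homotopic.Quotient.mk_refl, holeWinding_mk]
  have : (fun t => pathLoop Subtype.val (Path.refl x) t - (holeCentre n j : ℂ)) =
      fun _ => (x : ℂ) - holeCentre n j := by
    funext t
    simp [pathLoop]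
  rw [this, wind_const]

/-- **Conjugation invariance**: the loop `η · p · η⁻¹` (a loop at the start of the path `η`)
winds as often about `c_j` as `p` does — the variation of the argument along `η` cancels against
that along `η⁻¹`.  So the winding numbers of a closed curve in the page do not depend on the tail
chosen to read it as a based loop (they are FREE-homotopy invariants). [cite: Ahlfors1979, §4.2.1] -/
theorem holeWinding_conj (j : Fin n) {x y : PlanarPage n} (η : Path y x) (p : Path x x) :
    holeWinding j (Path.Homotopic.Quotient.mk (η.trans (p.trans η.symm))) =
      holeWinding j (Path.Homotopic.Quotient.mk p) := by
  apply int_eq_of_mul_two_pi_I_eq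
  have hη := holeCentre_notMem_range_map η j
  have hp := holeCentre_notMem_range_map p j
  have hηs := holeCentre_notMem_range_map η.symm j
  have hpη := holeCentre_notMem_range_map (p.trans η.symm) j
  rw [Path.map_trans] at hpη
  rw [← argInc_map_eq_holeWinding_mul, ← argInc_map_eq_holeWinding_mul, Path.map_trans,
    Path.map_trans, Path.argInc_trans _ _ hη hpη, Path.argInc_trans _ _ hp hηs, ← Path.map_symm,
    Path.argInc_symm _ hη]
  ring

/-- **The hole circuit read in `ℂ`**: `∂_k(t) = c_k + ρ i e^{2πit}`. [folklore] -/
theorem coe_holeLoop_apply (k : Fin n) (t : unitInterval) :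
    ((holeLoop n k t : PlanarPage n) : ℂ) =
      holeCentre n k + holeRadius n * (I * exp (2 * π * (t : ℝ) * I)) := by
  show ((innerPt n k (-(t : ℝ)) : PlanarPage n) : ℂ) = _
  simp only [innerPt]
  rw [show (-(2 * (π : ℂ) * ((-(t : ℝ) : ℝ) : ℂ)) * I) = 2 * π * ((t : ℝ) : ℂ) * I by
    push_cast; ring]

/-- `ρ < ‖c_k - c_j‖` for distinct holes (the centres are `≥ 2/(n+1) = 8ρ` apart). [folklore] -/
theorem holeRadius_lt_norm_holeCentre_sub {j k : Fin n} (h : j ≠ k) :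
    holeRadius n < ‖(holeCentre n k : ℂ) - holeCentre n j‖ := by
  rw [← ofReal_sub, Complex.norm_real, Real.norm_eq_abs]
  have h1 := two_div_le_abs_holeCentre_sub (n := n) (Ne.symm h)
  have h2 := holeRadius_le_two_div_sub n
  have h3 := holeRadius_pos n
  linarith

/-- **The hole circuit `∂_k` winds once about its own centre and not at all about the other
centres**: about `c_k` it is the round circle `ρ i e^{2πit}` (winding number `1`); about `c_j`,
`j ≠ k`, it stays within `ρ < ‖c_k - c_j‖` of the nonzero constant `c_k - c_j` (Rouché).
[cite: Ahlfors1979, §4.2.1] -/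
theorem wind_holeLoop_sub_holeCentre (j k : Fin n) :
    wind (fun t => pathLoop Subtype.val (holeLoop n k) t - holeCentre n j) =
      if j = k then 1 else 0 := by
  have heq : EqOn (fun t => pathLoop Subtype.val (holeLoop n k) t - (holeCentre n j : ℂ))
      (fun t => ((holeCentre n k : ℂ) - holeCentre n j) + (holeRadius n * I) * circleLoop 0 1 t)
      (Icc 0 1) := by
    intro t ht
    simp only
    rw [pathLoop_apply_of_mem _ _ ht, coe_holeLoop_apply, circleLoop_apply]
    push_cast
    ring
  rw [wind_congr heq]
  have hρ : (holeRadius n : ℂ) * I ≠ 0 :=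
    mul_ne_zero (ofReal_ne_zero.2 (holeRadius_pos n).ne') I_ne_zero
  have hcirc : IsNonvanishingLoop (circleLoop 0 1) := isNonvanishingLoop_circleLoop (by simp)
  by_cases hjk : j = k
  · subst hjk
    simp only [if_true, sub_self, zero_add]
    rw [wind_mul (IsNonvanishingLoop.const hρ) hcirc, wind_const, wind_circleLoop_zero one_pos,
      zero_add]
  · rw [if_neg hjk]
    have hc : (holeCentre n k : ℂ) - holeCentre n j ≠ 0 :=
      norm_pos_iff.1 ((holeRadius_pos n).trans (holeRadius_lt_norm_holeCentre_sub hjk))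
    refine (wind_eq_of_norm_sub_lt ?_ ?_ (IsNonvanishingLoop.const hc) fun t _ => ?_).trans
      (wind_const _)
    · exact (continuous_const.add (continuous_const.mul (continuous_circleLoop 0 1))).continuousOn
    · simp only [circleLoop_zero_eq]
    · rw [add_sub_cancel_left, norm_mul, norm_mul, Complex.norm_real, norm_I, mul_one,
        Real.norm_eq_abs, abs_of_pos (holeRadius_pos n), circleLoop_apply, zero_add, ofReal_one,
        one_mul, show (2 * (π : ℂ) * (t : ℂ) * I) = ((2 * π * t : ℝ) : ℂ) * I by push_cast; ring,
        norm_exp_ofReal_mul_I, mul_one]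
      exact holeRadius_lt_norm_holeCentre_sub hjk

/-- **The lasso `x_k = δ_k · ∂_k · δ_k⁻¹` winds `δ_{jk}` times about `c_j`** (conjugation
invariance and the hole circuit). [cite: FarbMargalit2012, §1.3] -/
theorem holeWinding_lasso (j k : Fin n) :
    holeWinding j (Path.Homotopic.Quotient.mk (lasso n k)) = if j = k then 1 else 0 := by
  rw [← wind_holeLoop_sub_holeCentre j k, ← holeWinding_mk, lasso]
  exact holeWinding_conj j (arc n k) (holeLoop n k)

/-- **The loop spelled by a word `w ∈ F_n` in the lassos winds `holeExp j w` times about `c_j`**: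
the exponent sum of `x_j` in `w` — i.e. `holeWinding j ∘ wordClass n` is the `j`-th coordinate
of the abelianisation `F_n → H₁(P_n; ℤ) = ℤⁿ`. [cite: FarbMargalit2012, §1.3] -/
theorem holeWinding_wordClass (j : Fin n) (w : FreeGroup (Fin n)) :
    holeWinding j (wordClass n w) = Multiplicative.toAdd (PlanarWords.holeExp j w) := by
  induction w using FreeGroup.induction_on with
  | C1 => rw [wordClass_one, holeWinding_refl, map_one, toAdd_one]
  | of k =>
      rw [wordClass_of, PlanarWords.holeExp_of]
      refine (holeWinding_lasso j k).trans ?_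
      by_cases h : k = j
      · subst h; simp
      · rw [if_neg (Ne.symm h), if_neg h, toAdd_one]
  | inv_of k ih => rw [wordClass_inv, holeWinding_symm, ih, map_inv, toAdd_inv]
  | mul x y hx hy => rw [wordClass_mul, holeWinding_trans, hx, hy, map_mul, toAdd_mul]

end PlanarPage

/-! ### §3 The core of a cycle realising a syntactic curve winds as its hole set prescribes -/

namespace SignedCycle

variable {n : ℕ}

/-- **The vanishing cycle realising `c` encloses (homologically) exactly the holes of the hole set
of `c`.**  If the signed cycle `γ` on the smooth model page realises the syntactic curve
`c = g(c_[a,b])` (`Realises`: its core, read in the topological page, is freely homotopic to the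
loop spelled by `cls n c`), then the winding number of the core about the centre `c_j` of hole `j`
is the exponent sum `holeExp j (cls n c)` — `1` for `j ∈ π_g([a, b])`, `0` otherwise
(`PlanarWords.toAdd_holeExp_cls`).  Winding numbers are free-homotopy invariants
(`PlanarPage.holeWinding_conj`), so the tail `η` of `Realises` drops out.  This is the class
`[γ] = Σ_j wind_j(γ) [∂_j] ∈ H₁(P_n; ℤ)` that the `H₁` reader `H₁(X(P_n; w)) = H₁(P_n)/⟨[γᵢ]⟩`
(Gompf–Stipsicz 1999, §8.2, p. 292) and Oba's cancellation (Oba 2016, §3.2) consume.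
[cite: GompfStipsiczGSM1999, §8.2 p. 292] -/
theorem Realises.wind_core_sub_holeCentre {c : PlanarCurve} {γ : SignedCycle (SmoothPlanarPage n)}
    (h : γ.Realises n c) (j : Fin n) :
    wind (fun t => ((SmoothPlanarPage.toPlanarPage n (γ.curve (circlePt t)) : PlanarPage n) : ℂ) -
        PlanarPage.holeCentre n j) =
      Multiplicative.toAdd (PlanarWords.holeExp j (c.cls n)) := by
  obtain ⟨hγ, η, hq⟩ := h
  have h1 := congrArg (PlanarPage.holeWinding j) hq
  rw [PlanarPage.holeWinding_conj, PlanarPage.holeWinding_wordClass,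
    PlanarPage.holeWinding_mk] at h1
  rw [← h1]
  refine wind_congr fun t ht => ?_
  rw [pathLoop_apply_of_mem _ _ ht]
  rfl

/-- The same, as the hole-set indicator: the core winds once about the centres of the holes
`π_g([a, b])` of the syntactic curve `g(c_[a,b])` and not about the others. [folklore] -/
theorem Realises.wind_core_sub_holeCentre_eq_ite {c : PlanarCurve}
    {γ : SignedCycle (SmoothPlanarPage n)} (h : γ.Realises n c) (j : Fin n) :
    wind (fun t => ((SmoothPlanarPage.toPlanarPage n (γ.curve (circlePt t)) : PlanarPage n) : ℂ) -
        PlanarPage.holeCentre n j) =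
      if c.a ≤ ((PlanarWords.evalWord n c.g).perm.symm j).val ∧
          ((PlanarWords.evalWord n c.g).perm.symm j).val ≤ c.b then 1 else 0 := by
  rw [h.wind_core_sub_holeCentre j, PlanarWords.toAdd_holeExp_cls]

/-! ### §4 Re-spelling invariance: `Realises` only depends on the conjugacy class of `cls n c` -/

/-- **Re-spelling a letter by a syntactic curve with conjugate class does not change what a cycle
realises.**  If `γ` realises `c` and `cls n c'` is conjugate to `cls n c` in `F_n` (the two
syntactic curves spell freely homotopic loops — e.g. two spellings `g(c_[a,b])`, `g'(c_[a',b'])` of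
isotopic curves), then `γ` realises `c'`: prepend to the tail `η` a loop spelling the conjugator.
This is the invariance (d) promised in `PlanarLefschetzBody.lean`. [cite: FarbMargalit2012, §1.2.3] -/
theorem Realises.of_isConj {c c' : PlanarCurve} {γ : SignedCycle (SmoothPlanarPage n)}
    (h : γ.Realises n c) (hc : IsConj (c.cls n) (c'.cls n)) : γ.Realises n c' := by
  obtain ⟨hγ, η, hq⟩ := h
  obtain ⟨u, hu⟩ := isConj_iff.1 hc
  set ηu : Path (PlanarPage.basePoint n) (PlanarPage.basePoint n) :=
    Quotient.out (PlanarPage.wordClass n u) with hηu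
  have hout : Path.Homotopic.Quotient.mk ηu = PlanarPage.wordClass n u := Quotient.out_eq _
  refine ⟨hγ, ηu.trans η, ?_⟩
  calc Path.Homotopic.Quotient.mk ((ηu.trans η).trans ((γ.pageLoop hγ).trans (ηu.trans η).symm))
      = (Path.Homotopic.Quotient.mk ηu).trans
          ((Path.Homotopic.Quotient.mk (η.trans ((γ.pageLoop hγ).trans η.symm))).trans
            (Path.Homotopic.Quotient.mk ηu).symm) := by
        simp only [Path.trans_symm, Path.Homotopic.Quotient.mk_trans,
          Path.Homotopic.Quotient.mk_symm, Path.Homotopic.Quotient.trans_assoc]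
    _ = (PlanarPage.wordClass n u).trans ((PlanarPage.wordClass n (c.cls n)).trans
          (PlanarPage.wordClass n u).symm) := by rw [hout, hq]
    _ = PlanarPage.wordClass n (u * c.cls n * u⁻¹) := by
        rw [PlanarPage.wordClass_mul, PlanarPage.wordClass_mul, PlanarPage.wordClass_inv,
          Path.Homotopic.Quotient.trans_assoc]
    _ = PlanarPage.wordClass n (c'.cls n) := by rw [hu]

/-- `Realises` is invariant under re-spelling by conjugate classes, as an `iff`. [folklore] -/
theorem realises_iff_of_isConj {c c' : PlanarCurve} (γ : SignedCycle (SmoothPlanarPage n))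
    (hc : IsConj (c.cls n) (c'.cls n)) : γ.Realises n c ↔ γ.Realises n c' :=
  ⟨fun h => h.of_isConj hc, fun h => h.of_isConj hc.symm⟩

/-- Signed letters: same sign and conjugate classes realise the same cycles. [folklore] -/
theorem RealisesLetter.of_isConj {l l' : Letter} {γ : SignedCycle (SmoothPlanarPage n)}
    (h : γ.RealisesLetter n l) (hs : l.2 = l'.2) (hc : IsConj (l.1.cls n) (l'.1.cls n)) :
    γ.RealisesLetter n l' :=
  ⟨h.1.trans hs, h.2.of_isConj hc⟩

end SignedCycle

/-- Re-indexing a family along a cast of `Fin` does not change the list it enumerates.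
[folklore] -/
theorem ofFn_comp_finCast {α : Type*} {m k : ℕ} (h : k = m) (f : Fin m → α) :
    List.ofFn (f ∘ Fin.cast h) = List.ofFn f := by
  subst h
  rfl

universe u

/-- **Planar Lefschetz bodies are invariant under re-spelling the word by letters of the same
signs with conjugate classes** (letterwise): the same family of signed cycles realises the new
word, and the underlying Lefschetz handlebody over the model page is literally the same.  In
particular `IsPlanarLefschetzBody X n w` only depends on the signs and the conjugacy classes
`[cls n cᵢ] ⊂ F_n` (the free homotopy classes of the curves) of the letters of `w`.
[cite: FarbMargalit2012, §1.2.3] -/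
theorem IsPlanarLefschetzBody.of_forall₂_isConj {X : Type u} [TopologicalSpace X]
    [ChartedSpace (EuclideanHalfSpace 4) X] {n : ℕ} {w w' : List Letter}
    (h : IsPlanarLefschetzBody X n w)
    (hw : List.Forall₂ (fun l l' : Letter => l.2 = l'.2 ∧ IsConj (l.1.cls n) (l'.1.cls n)) w w') :
    IsPlanarLefschetzBody X n w' := by
  obtain ⟨γ, hγ, hX⟩ := h
  obtain ⟨hlen, hget⟩ := List.forall₂_iff_get.1 hw
  refine ⟨γ ∘ Fin.cast hlen.symm, fun i => ?_, ?_⟩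
  · obtain ⟨hs, hc⟩ := hget i.val (hlen.symm ▸ i.isLt) i.isLt
    exact (hγ (Fin.cast hlen.symm i)).of_isConj hs hc
  · rw [ofFn_comp_finCast]
    exact hX

/-- **Planar word manifolds are invariant under re-spelling the word by letters of the same signs
with conjugate classes** (letterwise). [cite: FarbMargalit2012, §1.2.3] -/
theorem IsPlanarWordManifold.of_forall₂_isConj {M : Type u} [TopologicalSpace M]
    [ChartedSpace (EuclideanSpace ℝ (Fin 4)) M] {n : ℕ} {w w' : List Letter}
    (h : IsPlanarWordManifold M n w)
    (hw : List.Forall₂ (fun l l' : Letter => l.2 = l'.2 ∧ IsConj (l.1.cls n) (l'.1.cls n)) w w') :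
    IsPlanarWordManifold M n w' := by
  obtain ⟨γ, hγ, hM⟩ := h
  obtain ⟨hlen, hget⟩ := List.forall₂_iff_get.1 hw
  refine ⟨γ ∘ Fin.cast hlen.symm, fun i => ?_, ?_⟩
  · obtain ⟨hs, hc⟩ := hget i.val (hlen.symm ▸ i.isLt) i.isLt
    exact (hγ (Fin.cast hlen.symm i)).of_isConj hs hc
  · rw [ofFn_comp_finCast]
    exact hM

/-! ### §5 The abelianisation in coordinates: `Unimodular` ⇔ the exponent vectors of the curves
generate `ℤⁿ`; a unimodular factorisation of minimal length has pairwise distinct hole sets -/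

namespace PlanarWords

variable {n : ℕ}

/-- **The coordinates of the abelianisation**: `F_nᵃᵇ → ℤⁿ`, `y ↦ (holeExpAb j y)_j` (written
multiplicatively) — the isomorphism `H₁(P_n; ℤ) = F_nᵃᵇ ≅ ℤⁿ` given by the exponent sums of the
lassos. [folklore] -/
def abCoord (n : ℕ) : Abelianization (FreeGroup (Fin n)) →* Multiplicative (Fin n → ℤ) where
  toFun y := Multiplicative.ofAdd fun j => Multiplicative.toAdd (holeExpAb j y)
  map_one' := by
    refine Multiplicative.toAdd.injective ?_
    funext j
    simp
  map_mul' y z := by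
    refine Multiplicative.toAdd.injective ?_
    funext j
    simp

/-- The coordinates of the class of a word are its exponent sums. [folklore] -/
@[simp] theorem toAdd_abCoord_of (x : FreeGroup (Fin n)) (j : Fin n) :
    Multiplicative.toAdd (abCoord n (Abelianization.of x)) j = Multiplicative.toAdd (holeExp j x) := by
  simp [abCoord]

/-- Pointwise formula for the coordinates. [folklore] -/
theorem toAdd_abCoord_apply (y : Abelianization (FreeGroup (Fin n))) (j : Fin n) :
    Multiplicative.toAdd (abCoord n y) j = Multiplicative.toAdd (holeExpAb j y) := rfl

/-- **The inverse coordinates**: `ℤⁿ → F_nᵃᵇ`, `v ↦ ∏_j [x_j]^{v_j}`. [folklore] -/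
def abOfCoord (n : ℕ) : Multiplicative (Fin n → ℤ) →* Abelianization (FreeGroup (Fin n)) where
  toFun v := ∏ j, Abelianization.of (FreeGroup.of j) ^ (Multiplicative.toAdd v j)
  map_one' := by simp
  map_mul' v w := by
    simp only [toAdd_mul, Pi.add_apply, zpow_add, Finset.prod_mul_distrib]

/-- `abOfCoord` after `abCoord` is the identity (checked on the generators `[x_i]`). [folklore] -/
theorem abOfCoord_comp_abCoord : (abOfCoord n).comp (abCoord n) = MonoidHom.id _ := by
  refine Abelianization.hom_ext _ _ (FreeGroup.ext_hom _ _ fun i => ?_)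
  simp only [MonoidHom.comp_apply, MonoidHom.id_apply]
  show (∏ j, Abelianization.of (FreeGroup.of j) ^
      (Multiplicative.toAdd (abCoord n (Abelianization.of (FreeGroup.of i))) j)) = _
  rw [Finset.prod_eq_single i]
  · rw [toAdd_abCoord_of, holeExp_of_self, toAdd_ofAdd, zpow_one]
  · intro j _ hji
    rw [toAdd_abCoord_of, holeExp_of_ne (Ne.symm hji), toAdd_one, zpow_zero]
  · intro hi
    exact absurd (Finset.mem_univ i) hi

/-- `abCoord` after `abOfCoord` is the identity (exponent sums of `∏_j [x_j]^{v_j}`). [folklore] -/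
theorem abCoord_comp_abOfCoord : (abCoord n).comp (abOfCoord n) = MonoidHom.id _ := by
  refine MonoidHom.ext fun v => ?_
  refine Multiplicative.toAdd.injective ?_
  funext j
  simp only [MonoidHom.comp_apply, MonoidHom.id_apply, toAdd_abCoord_apply]
  show Multiplicative.toAdd (holeExpAb j
      (∏ k, Abelianization.of (FreeGroup.of k) ^ (Multiplicative.toAdd v k))) = _
  rw [map_prod, toAdd_prod]
  simp only [map_zpow, holeExpAb_of, holeExp_of, toAdd_zpow]
  rw [Finset.sum_eq_single j]
  · simp
  · intro k _ hkj
    simp [hkj]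
  · intro hj
    exact absurd (Finset.mem_univ j) hj

/-- **`F_nᵃᵇ ≅ ℤⁿ` by exponent sums.** [folklore] -/
def abCoordEquiv (n : ℕ) : Abelianization (FreeGroup (Fin n)) ≃* Multiplicative (Fin n → ℤ) :=
  (abCoord n).toMulEquiv (abOfCoord n) abOfCoord_comp_abCoord abCoord_comp_abOfCoord

/-- The equivalence is `abCoord` on elements. [folklore] -/
@[simp] theorem abCoordEquiv_apply (y : Abelianization (FreeGroup (Fin n))) :
    abCoordEquiv n y = abCoord n y := rfl

/-- **The exponent vector of a syntactic curve**: `(holeExp j (cls n c))_j ∈ ℤⁿ`, the `0/1`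
indicator of its hole set (`toAdd_holeExp_cls`) — the row of the "hole-set matrix" of a
factorisation. [folklore] -/
def expVec (n : ℕ) (c : PlanarCurve) : Fin n → ℤ := fun j => Multiplicative.toAdd (holeExp j (c.cls n))

/-- The exponent vector is the coordinate vector of the class. [folklore] -/
theorem abCoord_of_cls (c : PlanarCurve) :
    abCoord n (Abelianization.of (c.cls n)) = Multiplicative.ofAdd (expVec n c) := by
  refine Multiplicative.toAdd.injective ?_
  funext j
  rw [toAdd_abCoord_of, toAdd_ofAdd, expVec]

/-- **`Unimodular n A` ⇔ the exponent vectors (hole-set rows) of the curves of `A` generate `ℤⁿ`**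
— `H₁(X(P_n; A); ℤ) = ℤⁿ/⟨rows⟩ = 0` read in coordinates. [folklore] -/
theorem unimodular_iff_closure_expVec_eq_top (A : List PlanarCurve) :
    Unimodular n A ↔ AddSubgroup.closure {v : Fin n → ℤ | ∃ c ∈ A, v = expVec n c} = ⊤ := by
  classical
  set S : Set (Abelianization (FreeGroup (Fin n))) :=
    {x | x ∈ A.map fun c => Abelianization.of (PlanarCurve.cls n c)} with hS
  set T : Set (Fin n → ℤ) := {v | ∃ c ∈ A, v = expVec n c} with hT
  have hE : ∀ c : PlanarCurve, (abCoordEquiv n).symm (Multiplicative.ofAdd (expVec n c)) =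
      Abelianization.of (c.cls n) := fun c => by
    rw [MulEquiv.symm_apply_eq, abCoordEquiv_apply, abCoord_of_cls]
  -- images of the closure of `S` lie in the closure of `T`
  have h1 : ∀ y ∈ Subgroup.closure S,
      Multiplicative.toAdd (abCoordEquiv n y) ∈ AddSubgroup.closure T := by
    intro y hy
    refine Subgroup.closure_induction (fun x hx => ?_) ?_ ?_ ?_ hy
    · simp only [hS, Set.mem_setOf_eq, List.mem_map] at hx
      obtain ⟨c, hc, rfl⟩ := hx
      refine AddSubgroup.subset_closure ⟨c, hc, ?_⟩
      rw [abCoordEquiv_apply, abCoord_of_cls, toAdd_ofAdd]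
    · rw [map_one, toAdd_one]
      exact zero_mem _
    · intro x y _ _ hx hy
      rw [map_mul, toAdd_mul]
      exact add_mem hx hy
    · intro x _ hx
      rw [map_inv, toAdd_inv]
      exact neg_mem hx
  -- preimages of the closure of `T` lie in the closure of `S`
  have h2 : ∀ v ∈ AddSubgroup.closure T,
      (abCoordEquiv n).symm (Multiplicative.ofAdd v) ∈ Subgroup.closure S := by
    intro v hv
    refine AddSubgroup.closure_induction (fun x hx => ?_) ?_ ?_ ?_ hv
    · obtain ⟨c, hc, rfl⟩ := hx
      rw [hE]
      exact Subgroup.subset_closure (by simp only [hS, Set.mem_setOf_eq, List.mem_map]; exact ⟨c, hc, rfl⟩)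
    · rw [ofAdd_zero, map_one]
      exact one_mem _
    · intro x y _ _ hx hy
      rw [ofAdd_add, map_mul]
      exact mul_mem hx hy
    · intro x _ hx
      rw [ofAdd_neg, map_inv]
      exact inv_mem hx
  constructor
  · intro hU
    refine eq_top_iff.2 fun v _ => ?_
    have hy : (abCoordEquiv n).symm (Multiplicative.ofAdd v) ∈ Subgroup.closure S := by
      rw [show Subgroup.closure S = ⊤ from hU]
      exact Subgroup.mem_top _
    have := h1 _ hy
    rwa [MulEquiv.apply_symm_apply, toAdd_ofAdd] at this
  · intro hTtop
    change Subgroup.closure S = ⊤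
    refine eq_top_iff.2 fun y _ => ?_
    have hv : Multiplicative.toAdd (abCoordEquiv n y) ∈ AddSubgroup.closure T := by
      rw [hTtop]
      exact AddSubgroup.mem_top _
    have := h2 _ hv
    rwa [ofAdd_toAdd, MulEquiv.symm_apply_apply] at this

/-- **Exponent vectors generating `ℤⁿ`, `n` of them, are pairwise distinct and non-zero**: the
endomorphism of `ℤⁿ` sending the `i`-th basis vector to the `i`-th vector is onto, hence one-to-one
(`ℤⁿ` is Hopfian: Orzech / Vasconcelos). [folklore] -/
theorem injective_of_closure_range_eq_top {e : Fin n → (Fin n → ℤ)}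
    (h : AddSubgroup.closure (Set.range e) = ⊤) : Function.Injective e ∧ ∀ i, e i ≠ 0 := by
  classical
  let L : (Fin n → ℤ) →ₗ[ℤ] (Fin n → ℤ) := (Pi.basisFun ℤ (Fin n)).constr ℤ e
  have hLe : ∀ i, L (Pi.single i 1) = e i := fun i => by
    rw [← Pi.basisFun_apply ℤ]
    exact (Pi.basisFun ℤ (Fin n)).constr_basis ℤ e i
  have hsurj : Function.Surjective L := by
    intro v
    have hv : v ∈ AddSubgroup.closure (Set.range e) := by rw [h]; exact AddSubgroup.mem_top v
    have hle : AddSubgroup.closure (Set.range e) ≤ (LinearMap.range L).toAddSubgroup := by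
      rw [AddSubgroup.closure_le]
      rintro _ ⟨i, rfl⟩
      exact ⟨Pi.single i 1, hLe i⟩
    obtain ⟨w, hw⟩ := hle hv
    exact ⟨w, hw⟩
  have hinj : Function.Injective L := OrzechProperty.injective_of_surjective_endomorphism L hsurj
  refine ⟨fun i j hij => ?_, fun i hi => ?_⟩
  · have : Pi.single (M := fun _ : Fin n => ℤ) i (1 : ℤ) = Pi.single j 1 :=
      hinj (by rw [hLe, hLe, hij])
    by_contra hne
    have h1 := congrFun this i
    rw [Pi.single_eq_same, Pi.single_eq_of_ne hne] at h1
    exact one_ne_zero h1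
  · have : Pi.single (M := fun _ : Fin n => ℤ) i (1 : ℤ) = 0 := hinj (by rw [hLe, hi, map_zero])
    have h1 := congrFun this i
    rw [Pi.single_eq_same, Pi.zero_apply] at h1
    exact one_ne_zero h1

/-- **A unimodular factorisation of the minimal length `n` has pairwise distinct, nonempty hole
sets** (as exponent vectors): `n` rows generating `ℤⁿ` form a basis.  With Oba's parity step
(`Oba2016_exists_odd_block_of_unimodular`, `PlanarHomologySphereFillingsDictionary.lean`) this is
the combinatorial input of the case analysis of Oba 2016, §3.2 ("`α`, `β`, `γ` … at least one is a
boundary curve", and two equal curves would give `det = 0`). [cite: Oba2016, §3.2] -/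
theorem Unimodular.expVec_get_injective {A : List PlanarCurve} (hU : Unimodular n A)
    (hlen : A.length = n) :
    Function.Injective (fun i : Fin A.length => expVec n (A.get i)) ∧
      ∀ i : Fin A.length, expVec n (A.get i) ≠ 0 := by
  -- re-index the rows by `Fin n`
  let e : Fin n → (Fin n → ℤ) := fun i => expVec n (A.get (Fin.cast hlen.symm i))
  have hrange : Set.range e = {v : Fin n → ℤ | ∃ c ∈ A, v = expVec n c} := by
    ext v
    constructor
    · rintro ⟨i, rfl⟩
      exact ⟨A.get (Fin.cast hlen.symm i), List.get_mem _ _, rfl⟩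
    · rintro ⟨c, hc, rfl⟩
      obtain ⟨i, rfl⟩ := List.get_of_mem hc
      exact ⟨Fin.cast hlen i, by simp [e]⟩
  have h := (unimodular_iff_closure_expVec_eq_top A).1 hU
  rw [← hrange] at h
  obtain ⟨hinj, hne⟩ := injective_of_closure_range_eq_top h
  refine ⟨fun i j hij => ?_, fun i => ?_⟩
  · have := @hinj (Fin.cast hlen i) (Fin.cast hlen j) (by simpa [e] using hij)
    exact Fin.ext (by simpa using congrArg Fin.val this)
  · simpa [e] using hne (Fin.cast hlen i)

end PlanarWords

end Literature.Topology.FourManifolds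

end
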